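import Literature.Analysis.FunctionSpaces.WeakL1Limits
import HarnessLib

/-!
# Equi-integrable families against bounded a.e.-convergent weights (Egorov)

Topic: Analysis / FunctionSpaces. Companion to `WeakL1Limits`
(`TendstoWeaklyL1.mul_of_tendsto_ae`, CIP 1994 §5.3 Step 8): the *strong* form of the same
Egorov argument, which is the reduction "we may as well take `ψₙ = ψ` for all `n`" in the proof of
the velocity averaging lemma (Cercignani–Illner–Pulvirenti 1994, Lemma 5.3.9, p. 154: "because by
Egorov's theorem `ψₙ → ψ` uniformly except on a set of arbitrary small measure") and the
approximation step "`∫∫∫ |ψₖ - ψ| |gₙ| → 0` (by the Dunford–Pettis criterion)" there.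

* `eventually_forall_integral_abs_mul_sub_le` (**proved**): if `(f i)_{i ∈ ι}` is bounded in
  `L¹(μ)`, equi-integrable and uniformly tight, and `θₖ → θ` a.e. with `|θₖ| ≤ M` a.e., then for
  every `ε > 0`, eventually in `k`, `∫ |f i| |θₖ - θ| dμ ≤ ε` for **all** `i` simultaneously.
* `tendsto_integral_abs_mul_sub` (**proved**): the diagonal case `∫ |fₙ| |θₙ - θ| dμ → 0`.

Proof: off a set `s` of finite measure (tightness) and on a small exceptional set `t ⊆ s`
(equi-integrability) the `f i` carry little mass uniformly in `i`; on `s \ t`, `θₖ → θ`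
uniformly by Egorov's theorem (`MeasureTheory.tendstoUniformlyOn_of_ae_tendsto`).

## References

* C. Cercignani, R. Illner, M. Pulvirenti, *The Mathematical Theory of Dilute Gases*, Springer
  (1994), §5.3 Step 8 (p. 148) and proof of Lemma 5.3.9 (p. 154). [CIPDiluteGases1994]
-/

noncomputable section

open MeasureTheory Filter Topology Set
open scoped ENNReal NNReal

namespace Literature.Analysis.FunctionSpaces

variable {α : Type*} [MeasurableSpace α] {μ : Measure α}

/-- **Equi-integrable families against bounded a.e.-convergent weights.** Let `(f i)_{i ∈ ι}` be
integrable, bounded in `L¹(μ)`, equi-integrable (`UnifIntegrable`) and uniformly tight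
(`UnifTight`), and let `θₖ → θ` a.e. with `|θₖ| ≤ M` a.e. Then for every `ε > 0`, for all
sufficiently large `k`, `∫ |f i| |θₖ - θ| dμ ≤ ε` for every `i` (CIP 1994, proof of Lemma 5.3.9,
p. 154: Egorov's theorem off a small set, on which the family carries uniformly little mass). [cite: CIPDiluteGases1994, §5.3 Lemma 5.3.9 (proof, p. 154)] -/
theorem eventually_forall_integral_abs_mul_sub_le {ι : Type*} {f : ι → α → ℝ}
    (hfi : ∀ i, Integrable (f i) μ) (hbd : ∃ K : ℝ, ∀ i, ∫ x, |f i x| ∂μ ≤ K)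
    (hUI : UnifIntegrable f 1 μ) (hUT : UnifTight f 1 μ)
    {θ : ℕ → α → ℝ} {θ' : α → ℝ} {M : ℝ}
    (hθ : ∀ k, AEStronglyMeasurable (θ k) μ) (hθM : ∀ k, ∀ᵐ x ∂μ, |θ k x| ≤ M)
    (hlim : ∀ᵐ x ∂μ, Tendsto (fun k => θ k x) atTop (𝓝 (θ' x))) {ε : ℝ} (hε : 0 < ε) :
    ∀ᶠ k in atTop, ∀ i, ∫ x, |f i x| * |θ k x - θ' x| ∂μ ≤ ε := by
  obtain ⟨K, hK⟩ := hbd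
  -- nonnegative versions of the constants
  set M' := max M 0 with hM'
  set K' := max K 0 with hK'
  have hM'0 : 0 ≤ M' := le_max_right _ _
  have hK'0 : 0 ≤ K' := le_max_right _ _
  have hθM' : ∀ k, ∀ᵐ x ∂μ, |θ k x| ≤ M' := fun k =>
    (hθM k).mono fun x hx => hx.trans (le_max_left _ _)
  have hK'i : ∀ i, ∫ x, |f i x| ∂μ ≤ K' := fun i => (hK i).trans (le_max_left _ _)
  -- the a.e. limit is measurable and bounded by `M'`
  have hθ' : AEStronglyMeasurable θ' μ := aestronglyMeasurable_of_tendsto_ae atTop hθ hlim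
  have hallM : ∀ᵐ x ∂μ, ∀ k, |θ k x| ≤ M' := ae_all_iff.2 hθM'
  have hθ'M : ∀ᵐ x ∂μ, |θ' x| ≤ M' := by
    filter_upwards [hlim, hallM] with x hx hxM
    exact le_of_tendsto ((continuous_abs.tendsto _).comp hx) (Eventually.of_forall hxM)
  -- choose `η`
  set L := 4 * M' + K' with hL
  have hL0 : 0 ≤ L := by positivity
  set η := ε / (L + 1) with hη
  have hη0 : 0 < η := by positivity
  have hLη : L * η ≤ ε := by
    rw [hη, mul_div_assoc', div_le_iff₀ (by positivity)]
    nlinarith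
  -- uniform tightness: a set `s` of finite measure off which all `f i` are `η`-small
  obtain ⟨s₀, hs₀, hs₀f⟩ := (unifTight_iff_real f 1 μ).1 hUT hη0
  set s := toMeasurable μ s₀ with hs_def
  have hs : MeasurableSet s := measurableSet_toMeasurable μ s₀
  have hsfin : μ s ≠ ∞ := by rwa [hs_def, measure_toMeasurable]
  have hsf : ∀ i, eLpNorm (sᶜ.indicator (f i)) 1 μ ≤ ENNReal.ofReal η := fun i => by
    refine le_trans (eLpNorm_mono fun x => ?_) (hs₀f i)
    exact norm_indicator_le_of_subset (compl_subset_compl.2 (subset_toMeasurable μ s₀)) _ _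
  -- equi-integrability: `δ`
  obtain ⟨δ, hδ, hδf⟩ := hUI hη0
  -- Egorov on `s` for strongly measurable versions of `θₖ, θ'`
  set θt : ℕ → α → ℝ := fun k => (hθ k).mk (θ k) with hθt
  set θt' : α → ℝ := hθ'.mk θ' with hθt'
  have hall : ∀ᵐ x ∂μ, ∀ k, θ k x = θt k x := ae_all_iff.2 fun k => (hθ k).ae_eq_mk
  have h' : ∀ᵐ x ∂μ, θ' x = θt' x := hθ'.ae_eq_mk
  have hlimt : ∀ᵐ x ∂μ, x ∈ s → Tendsto (fun k => θt k x) atTop (𝓝 (θt' x)) := by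
    filter_upwards [hlim, hall, h'] with x hx hxall hx' _
    rw [← hx']
    exact hx.congr fun k => hxall k
  obtain ⟨t, _, ht, hμt, hunif⟩ := tendstoUniformlyOn_of_ae_tendsto
    (fun k => (hθ k).stronglyMeasurable_mk) hθ'.stronglyMeasurable_mk hs hsfin hlimt hδ
  have htf : ∀ i, eLpNorm (t.indicator (f i)) 1 μ ≤ ENNReal.ofReal η := fun i => hδf i t ht hμt
  have hev : ∀ᶠ k in atTop, ∀ x ∈ s \ t, dist (θt' x) (θt k x) < η :=
    Metric.tendstoUniformlyOn_iff.1 hunif η hη0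
  refine hev.mono fun k hk i => ?_
  -- pointwise a.e. bound on `|f i| |θₖ - θ'|`
  set b : α → ℝ := fun x => |f i x| * (2 * M' * (sᶜ.indicator (fun _ => (1 : ℝ)) x +
    t.indicator (fun _ => (1 : ℝ)) x) + η) with hb
  have hind0 : ∀ x, 0 ≤ sᶜ.indicator (fun _ => (1 : ℝ)) x + t.indicator (fun _ => (1 : ℝ)) x :=
    fun x => add_nonneg (Set.indicator_nonneg (fun _ _ => zero_le_one) _)
      (Set.indicator_nonneg (fun _ _ => zero_le_one) _)
  have hpt : ∀ᵐ x ∂μ, |f i x| * |θ k x - θ' x| ≤ b x := by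
    filter_upwards [hall, h', hallM, hθ'M] with x hx1 hx2 hx3 hx4
    refine mul_le_mul_of_nonneg_left ?_ (abs_nonneg _)
    by_cases hx : x ∈ s \ t
    · have := hk x hx
      rw [Real.dist_eq, ← hx1 k, ← hx2, abs_sub_comm] at this
      have hind : 0 ≤ 2 * M' * (sᶜ.indicator (fun _ => (1 : ℝ)) x +
          t.indicator (fun _ => (1 : ℝ)) x) := mul_nonneg (by positivity) (hind0 x)
      linarith
    · have hind : (1 : ℝ) ≤ sᶜ.indicator (fun _ => (1 : ℝ)) x + t.indicator (fun _ => (1 : ℝ)) x := by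
        rw [Set.mem_sdiff, not_and_or, not_not] at hx
        rcases hx with hx | hx
        · have : sᶜ.indicator (fun _ => (1 : ℝ)) x = 1 := by simp [hx]
          rw [this]
          linarith [Set.indicator_nonneg (fun _ _ => (zero_le_one : (0 : ℝ) ≤ 1)) (s := t) x]
        · have : t.indicator (fun _ => (1 : ℝ)) x = 1 := by simp [hx]
          rw [this]
          linarith [Set.indicator_nonneg (fun _ _ => (zero_le_one : (0 : ℝ) ≤ 1)) (s := sᶜ) x]
      calc |θ k x - θ' x| ≤ |θ k x| + |θ' x| := abs_sub _ _
        _ ≤ 2 * M' * 1 + 0 := by linarith [hx3 k, hx4]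
        _ ≤ _ := by nlinarith [hη0.le]
  -- integrability of the bound and of the left-hand side
  have hbd1 : ∀ u : Set α, ∀ᵐ x ∂μ, ‖u.indicator (fun _ => (1 : ℝ)) x‖ ≤ 1 := fun u =>
    Eventually.of_forall fun x => by
      by_cases hx : x ∈ u <;> simp [hx]
  have hind_s : AEStronglyMeasurable (sᶜ.indicator fun _ => (1 : ℝ)) μ :=
    (aestronglyMeasurable_const (b := (1 : ℝ))).indicator hs.compl
  have hind_t : AEStronglyMeasurable (t.indicator fun _ => (1 : ℝ)) μ :=
    (aestronglyMeasurable_const (b := (1 : ℝ))).indicator ht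
  have h1 : Integrable (fun x => |f i x| * sᶜ.indicator (fun _ => (1 : ℝ)) x) μ :=
    (hfi i).abs.mul_bdd hind_s (hbd1 sᶜ)
  have h2 : Integrable (fun x => |f i x| * t.indicator (fun _ => (1 : ℝ)) x) μ :=
    (hfi i).abs.mul_bdd hind_t (hbd1 t)
  have h3 : Integrable (fun x => |f i x| * η) μ := (hfi i).abs.mul_const η
  have eb : ∀ x, b x = (2 * M' * (|f i x| * sᶜ.indicator (fun _ => (1 : ℝ)) x) +
      2 * M' * (|f i x| * t.indicator (fun _ => (1 : ℝ)) x)) + |f i x| * η := fun x => by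
    simp only [hb]; ring
  have hbi : Integrable b μ := by
    rw [show b = _ from funext eb]
    exact ((h1.const_mul _).add (h2.const_mul _)).add h3
  -- the estimate
  have hI : ∫ x, b x ∂μ ≤ 4 * M' * η + K' * η := by
    have e1 := integral_abs_mul_indicator_le_of_eLpNorm_le (hfi i) hs.compl hη0.le (hsf i)
    have e2 := integral_abs_mul_indicator_le_of_eLpNorm_le (hfi i) ht hη0.le (htf i)
    have e3 : ∫ x, |f i x| * η ∂μ ≤ K' * η := by
      rw [integral_mul_const]; nlinarith [hK'i i, hη0.le]
    have hsplit : ∫ x, b x ∂μ = 2 * M' * ∫ x, |f i x| * sᶜ.indicator (fun _ => (1 : ℝ)) x ∂μ +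
        2 * M' * ∫ x, |f i x| * t.indicator (fun _ => (1 : ℝ)) x ∂μ + ∫ x, |f i x| * η ∂μ := by
      calc ∫ x, b x ∂μ
          = ∫ x, ((2 * M' * (|f i x| * sᶜ.indicator (fun _ => (1 : ℝ)) x) +
              2 * M' * (|f i x| * t.indicator (fun _ => (1 : ℝ)) x)) + |f i x| * η) ∂μ :=
            integral_congr_ae (Eventually.of_forall eb)
        _ = ∫ x, (2 * M' * (|f i x| * sᶜ.indicator (fun _ => (1 : ℝ)) x) +
              2 * M' * (|f i x| * t.indicator (fun _ => (1 : ℝ)) x)) ∂μ + ∫ x, |f i x| * η ∂μ :=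
            integral_add ((h1.const_mul _).add (h2.const_mul _)) h3
        _ = (∫ x, 2 * M' * (|f i x| * sᶜ.indicator (fun _ => (1 : ℝ)) x) ∂μ +
              ∫ x, 2 * M' * (|f i x| * t.indicator (fun _ => (1 : ℝ)) x) ∂μ) +
                ∫ x, |f i x| * η ∂μ := by
            rw [integral_add (h1.const_mul _) (h2.const_mul _)]
        _ = _ := by rw [integral_const_mul, integral_const_mul]
    rw [hsplit]
    nlinarith
  calc ∫ x, |f i x| * |θ k x - θ' x| ∂μ ≤ ∫ x, b x ∂μ :=
        integral_mono_of_nonneg (Eventually.of_forall fun x => by positivity) hbi hpt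
    _ ≤ 4 * M' * η + K' * η := hI
    _ = L * η := by rw [hL]; ring
    _ ≤ ε := hLη

/-- **Diagonal form**: under the hypotheses of `eventually_forall_integral_abs_mul_sub_le` for a
sequence `(fₙ)`, `∫ |fₙ| |θₙ - θ| dμ → 0` (CIP 1994, proof of Lemma 5.3.9, p. 154: "we may as
well take `ψₙ = ψ` for all `n`"). [cite: CIPDiluteGases1994, §5.3 Lemma 5.3.9 (proof, p. 154)] -/
theorem tendsto_integral_abs_mul_sub {f : ℕ → α → ℝ}
    (hfi : ∀ n, Integrable (f n) μ) (hbd : ∃ K : ℝ, ∀ n, ∫ x, |f n x| ∂μ ≤ K)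
    (hUI : UnifIntegrable f 1 μ) (hUT : UnifTight f 1 μ)
    {θ : ℕ → α → ℝ} {θ' : α → ℝ} {M : ℝ}
    (hθ : ∀ k, AEStronglyMeasurable (θ k) μ) (hθM : ∀ k, ∀ᵐ x ∂μ, |θ k x| ≤ M)
    (hlim : ∀ᵐ x ∂μ, Tendsto (fun k => θ k x) atTop (𝓝 (θ' x))) :
    Tendsto (fun n => ∫ x, |f n x| * |θ n x - θ' x| ∂μ) atTop (𝓝 0) := by
  rw [Metric.tendsto_nhds]
  intro ε hε
  have h := eventually_forall_integral_abs_mul_sub_le hfi hbd hUI hUT hθ hθM hlim (half_pos hε)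
  refine h.mono fun n hn => ?_
  rw [dist_zero_right, Real.norm_of_nonneg (integral_nonneg fun x => by positivity)]
  exact (hn n).trans_lt (half_lt_self hε)

end Literature.Analysis.FunctionSpaces
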